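import Summits.MatrixMultiplication.MatrixMultiplication.Theorems.OutsiderSandwichNoExactPerfectPacking
import Summits.MatrixMultiplication.MatrixMultiplication.Theorems.OutsiderSandwichMinrankGap
import Literature.LinearAlgebra.Matrix.RankInequalities
import Summits.MatrixMultiplication.MatrixMultiplication.Theorems.OutsiderSandwichTightSubrank
import Summits.MatrixMultiplication.MatrixMultiplication.Theorems.OutsiderSandwichDegenerationWitnessRestrictions
import Literature.Barriers.MatrixMultiplication.IrreversibilityBarrierProofs

/-!
# OutsiderSandwich — the PACKING SLACK LAW of the `cw₂`-tower: `2·(3^N − B·m²) ≥ 2^N − m`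
(decomp-mm lens 4 «minimal-counterexample / extremal reduction», gen 38; kernel K38-1)

ω-free, proved outright.  The exact law of gen 37 (`CwTwoNoExactPerfectPacking`, item
stmt-MatrixMultiplication-32272: a packing `⟨B⟩ ⊗ ⟨m,m,m⟩ ≤ cw₂^{⊠N}` never fills the format,
`B·m² < 3^N`) is made QUANTITATIVE and UNIFORM IN `N`:

**Theorem** (`slack_law`).  If `⟨B⟩ ⊗ ⟨m,m,m⟩` (`B, m ≥ 1`) is a restriction of `cw₂^{⊠N}` then
`2^N + 2·B·m² ≤ m + 2·3^N`, i.e. the volume deficit `s = 3^N − B·m²` satisfies `2s ≥ 2^N − m`.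

Proof — minrank with slack (the lens: the extremal packing leaves the least room, and the least room
is still `⌈(2^N − m)/2⌉`).  Write the restriction as `P = (α ⊗ β ⊗ γ)·T`.  `P` is concise, so `αᵀ` is
injective and `β, γ` have rank `B·m²`, i.e. kernels of dimension `s` (`rank_of_eq_card`).  Take the
coordinate covector `ξ = e_{(0,(0,0))}`: the slice `P(ξ)` has rank `≤ m`
(`rank_contract3_unitKronecker_matMul_single_le`, gen 33), it is the sandwich `β · T(αᵀξ) · γᵀ`
(`sliceMat_restricts`, gen 6), and EVERY non-zero slice of `cw₂^{⊠N}` has rank `≥ 2^N`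
(`two_pow_le_rank_contract3_unitKronecker_cwTwoPow`, gen 33, transported to `sliceMat` in
`two_pow_le_rank_sliceMat_cwPow`).  Sylvester's inequality twice (`rank_le_rank_sandwich_add`):
`m ≥ rank P(ξ) ≥ rank T(αᵀξ) − s − s ≥ 2^N − 2s`.

The general form is `floor_le_of_restricts`: for ANY tensor `t` whose non-zero first-mode slices have
rank `≥ r` and any concise `s ≤ t` with a slice of rank `≤ ρ`,
`r + #κ' + #μ' ≤ ρ + #κ + #μ` — minrank is lower semicontinuous under restriction UP TO THE FORMAT
DROP of the two passive legs (the equal-format case `#κ = #κ'`, `#μ = #μ'` is the minrank transport of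
gens 33/37; the new content is the slack).

Corollaries (all ω-free):
* `mul_sq_lt_three_pow_of_slack` — the exact law of gen 37 re-derived in three lines
  (`m ≤ 3^{N/2} < 2^N`; the by-name closer of the aside stays gen 37's);
* `slack_law_copies` — the same floor for packings into `n` COPIES `⟨n⟩ ⊠ cw₂^{⊠N}`:
  `2^N + 2·B·m² ≤ m + 2·n·3^N`; the deficit does not grow with `n` (honest reach of a one-slice
  invariant);
* `subrank_floor`, `subrank_window`, `subrank_cwPow_one` — `m = 1`:
  `2^N ≤ Q(cw₂^{⊠N}) ≤ 3^N − ⌈(2^N − 1)/2⌉`, closing at `N = 1` to `Q(cw₂^{⊠1}) = 2`;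
* census cells newly EXCLUDED beyond volume (`B·m² < 3^N` allowed them): `19·⟨2,2,2⟩ ≰ cw₂^{⊠4}`,
  `5·⟨4,4,4⟩ ≰ cw₂^{⊠4}`, `26·⟨3,3,3⟩ ≰ cw₂^{⊠5}`, `44·⟨4,4,4⟩ ≰ cw₂^{⊠6}`, `11·⟨8,8,8⟩ ≰ cw₂^{⊠6}`
  (`not_pack_*`); in the laser family `N = 3k`, `m = 2^k`: `B ≤ (27/4)^k − 2^{k-1} + 2^{-k-1}`;
  the NODE-g37 handoff conjecture `9·B ≤ 3^N − 3^{N−2}` (`m = 3`) follows for `N ≤ 4` (`B ≤ 0, 2, 8`)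
  and the first undecided cell is `(N, m, B) = (5, 3, 25)` (conjectured bound `24`).

Honest tag: WEAKER·INSTRUMENT.  The floor lives at scale `2^N` while the volume is `3^N`: it cannot see
exponential rates (`PerfectAtLaser`: `B·m² ≥ 3^{(1−ε)N}` is achievable), so it does not move
`LaserTangency` / `LaserMergeOptimal`; it is the first `N`-uniform quantitative successor of the exact
law asked for in NODE-g37 (a) / critic g37 c3, and it is restriction-only (slice ranks drop under
degeneration).  Reach of the method (heuristic, recorded for the next generation): the covector
subspace `e_0^{⊗(N−j)} ⊗ (ℂ³)^{⊗j}` has dimension `3^j` and all its slices have rank `≤ 2^{N−j}·3^j`, so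
even a subspace / variety version of the transport (BILPS minrank varieties with slack) cannot push the
deficit beyond `O(2^N · m^{log₃(3/2)})` — slice-rank floors never reach the exponential scale.

## References
* M. Bläser, C. Ikenmeyer, V. Lysikov, A. Pandey, F.-O. Schreyer, *On the orbit closure containment
  problem and slice rank of tensors*, SODA 2021 (arXiv:1911.02534), Def. 13 (minrank).
  [BlaserIkenmeyerLysikovPandeySchreyer2019]
* R. A. Horn, C. R. Johnson, *Matrix Analysis*, 2nd ed., CUP 2013, §0.4.5 (c) (Sylvester).
  [HornJohnson2013]
* D. Coppersmith, S. Winograd, *Matrix multiplication via arithmetic progressions*,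
  J. Symbolic Comput. 9 (1990) 251–280, §6–7. [CoppersmithWinograd1990]
* P. Bürgisser, M. Clausen, M. A. Shokrollahi, *Algebraic Complexity Theory*, Springer 1997,
  §14.4, (15.25). [BurgisserClausenShokrollahi1997]
-/

set_option linter.dupNamespace false

namespace Summit.MatrixMultiplication.MatrixMultiplication.Theorems.OutsiderSandwichPackingSlack

open Literature.Computability.AlgebraicComplexity
open OutsiderSandwichNoExactPerfection OutsiderSandwichNoExactPerfectPacking OutsiderSandwichMinrankGap
open scoped Matrix

/-! ## 1. Linear algebra: the sandwich with slack -/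

section General

variable {K : Type*} [Field K]
variable {ι κ μ ι' κ' μ' : Type*} [Fintype ι] [Fintype κ] [Fintype μ]
  [Fintype ι'] [Fintype κ'] [Fintype μ']
  [DecidableEq ι] [DecidableEq κ] [DecidableEq μ] [DecidableEq ι'] [DecidableEq κ'] [DecidableEq μ']

omit [Fintype κ] [Fintype μ] [DecidableEq ι] [DecidableEq κ] [DecidableEq μ] in
/-- The gen-6 slice matrix is the BILPS contraction `contract3`. [folklore] -/
theorem sliceMat_eq_contract3 (t : ι → κ → μ → K) (η : ι → K) : sliceMat t η = contract3 t η := rfl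

omit [DecidableEq κ] in
/-- A matrix whose transpose acts injectively has full row count as rank: `rank (of B) = #κ'`.
[folklore] -/
theorem rank_of_eq_card {B : κ' → κ → K} (hB : Function.Injective (Matrix.toLin' (Matrix.of B)ᵀ)) :
    (Matrix.of B).rank = Fintype.card κ' := by
  rw [← Matrix.rank_transpose]
  unfold Matrix.rank
  rw [← Matrix.toLin'_apply', LinearMap.finrank_range_of_inj hB]
  simp [Module.finrank_fintype_fun_eq_card]

omit [DecidableEq κ] [DecidableEq μ] in
/-- **Sandwich with slack** (Sylvester twice): if `βᵀ, γᵀ` act injectively then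
`rank M + #κ' + #μ' ≤ rank (β M γᵀ) + #κ + #μ`, i.e. `rank (β M γᵀ) ≥ rank M − (#κ − #κ') − (#μ − #μ')`.
[cite: HornJohnson2013, §0.4.5 (c)] -/
theorem rank_le_rank_sandwich_add {B : κ' → κ → K} {C : μ' → μ → K}
    (hB : Function.Injective (Matrix.toLin' (Matrix.of B)ᵀ))
    (hC : Function.Injective (Matrix.toLin' (Matrix.of C)ᵀ)) (M : Matrix κ μ K) :
    M.rank + Fintype.card κ' + Fintype.card μ' ≤
      (Matrix.of B * M * (Matrix.of C)ᵀ).rank + Fintype.card κ + Fintype.card μ := by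
  have h1 := Literature.LinearAlgebra.Matrix.rank_add_rank_le_rank_mul_add_card
    (Matrix.of B) (M * (Matrix.of C)ᵀ)
  have h2 := Literature.LinearAlgebra.Matrix.rank_add_rank_le_rank_mul_add_card M (Matrix.of C)ᵀ
  rw [rank_of_eq_card hB] at h1
  rw [Matrix.rank_transpose, rank_of_eq_card hC] at h2
  rw [Matrix.mul_assoc]
  omega

/-- **Minrank with slack.**  Let every non-zero first-mode slice of `t` have rank `≥ r`, let `s` be
concise (its three slice families linearly independent) with a non-zero covector `ξ` whose slice has
rank `≤ ρ`.  If `s ≤ t` (restriction) then `r + #κ' + #μ' ≤ ρ + #κ + #μ`.  (Equal passive formats: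
`r ≤ ρ`, the minrank monotonicity behind gens 33/37.) [new] -/
theorem floor_le_of_restricts {t : ι → κ → μ → K} {s : ι' → κ' → μ' → K} {r ρ : ℕ}
    (hfloor : ∀ η : ι → K, η ≠ 0 → r ≤ (sliceMat t η).rank)
    (h1 : LinearIndependent K (fun a' => s a' : ι' → κ' → μ' → K))
    (h2 : LinearIndependent K (fun b' => rotate s b' : κ' → μ' → ι' → K))
    (h3 : LinearIndependent K (fun c' => rotate (rotate s) c' : μ' → ι' → κ' → K))
    {ξ : ι' → K} (hξ : ξ ≠ 0) (hρ : (sliceMat s ξ).rank ≤ ρ) (h : TensorRestrictsTo t s) :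
    r + Fintype.card κ' + Fintype.card μ' ≤ ρ + Fintype.card κ + Fintype.card μ := by
  obtain ⟨A, B, C, hs⟩ := h
  have hA := toLin'_injective_of_restricts hs h1
  have hB := toLin'_injective_of_restricts (restricts_rotate hs) h2
  have hC := toLin'_injective_of_restricts (restricts_rotate (restricts_rotate hs)) h3
  set η : ι → K := ξ ᵥ* Matrix.of A with hη
  have hη0 : η ≠ 0 := by
    intro h0
    apply hξ
    apply hA
    rw [map_zero, Matrix.toLin'_apply, Matrix.mulVec_transpose]
    exact h0
  have hS : sliceMat s ξ = Matrix.of B * sliceMat t η * (Matrix.of C)ᵀ := sliceMat_restricts hs ξ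
  have hsand := rank_le_rank_sandwich_add hB hC (sliceMat t η)
  rw [← hS] at hsand
  have hr := hfloor η hη0
  omega

end General

/-! ## 2. The two sides: `cw₂^{⊠N}` (floor `2^N`) and the targets `⟨B⟩ ⊗ ⟨m,m,m⟩`, `⟨Q⟩` -/

/-- **Every non-zero slice of `cw₂^{⊠N}` has rank `≥ 2^N`** — gen 33's
`two_pow_le_rank_contract3_unitKronecker_cwTwoPow` (stated there for `⟨n⟩ ⊠ cw₂^{⊠N}`), transported
to the plain power through `n = 1`. [cite: BlaserIkenmeyerLysikovPandeySchreyer2019, Def. 13] -/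
theorem two_pow_le_rank_sliceMat_cwPow {N : ℕ} {η : (Fin N → Fin 3) → ℂ} (hη : η ≠ 0) :
    2 ^ N ≤ (sliceMat (kroneckerPow (cwTensor ℂ 2) N) η).rank := by
  classical
  set x : Fin 1 × (Fin N → Fin 3) → ℂ := fun p => η p.2 with hx
  have hx0 : x ≠ 0 := by
    intro h
    apply hη
    funext a
    exact congr_fun h ((0 : Fin 1), a)
  have key : contract3 (kroneckerTensor (unitTensor ℂ 1) (kroneckerPow (cwTensor ℂ 2) N)) x =
      (sliceMat (kroneckerPow (cwTensor ℂ 2) N) η).submatrix Prod.snd Prod.snd := by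
    ext ⟨u, b⟩ ⟨u', c⟩
    have hu : u = 0 := Subsingleton.elim _ _
    have hu' : u' = 0 := Subsingleton.elim _ _
    subst hu hu'
    simp only [contract3_apply, Matrix.submatrix_apply, sliceMat, Matrix.of_apply,
      kroneckerTensor_apply, unitTensor_apply, hx, Fintype.sum_prod_type, Fintype.sum_unique,
      Fin.default_eq_zero, true_and, if_true, one_mul]
  calc 2 ^ N ≤ (contract3 (kroneckerTensor (unitTensor ℂ 1) (kroneckerPow (cwTensor ℂ 2) N)) x).rank :=
        two_pow_le_rank_contract3_unitKronecker_cwTwoPow hx0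
    _ = ((sliceMat (kroneckerPow (cwTensor ℂ 2) N) η).submatrix Prod.snd Prod.snd).rank := by
        rw [key]
    _ ≤ _ := Matrix.rank_submatrix_le _ _ _

/-- The coordinate slice `e_{(0,(0,0))}` of `⟨B⟩ ⊗ ⟨m,m,m⟩` has rank `≤ m` (gen 33, `sliceMat` form).
[cite: Blaser2013, §5] -/
theorem rank_sliceMat_pack_single_le (F m : ℕ) (p₀ : Fin F × (Fin m × Fin m)) :
    (sliceMat (kroneckerTensor (unitTensor ℂ F) (matMulTensor ℂ m m m))
      (fun a => if a = p₀ then 1 else 0)).rank ≤ m := by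
  rw [sliceMat_eq_contract3]
  exact rank_contract3_unitKronecker_matMul_single_le p₀

/-- The first-mode slice of the unit tensor `⟨Q⟩` at `ξ` is `diag ξ`. [folklore] -/
theorem sliceMat_unitTensor (Q : ℕ) (ξ : Fin Q → ℂ) :
    sliceMat (unitTensor ℂ Q) ξ = Matrix.diagonal ξ := by
  ext b c
  simp only [sliceMat, Matrix.of_apply, unitTensor_apply, mul_ite, mul_one, mul_zero,
    Matrix.diagonal_apply]
  by_cases hbc : b = c
  · subst hbc
    rw [if_pos rfl, Finset.sum_eq_single b (fun a _ ha => by simp [ha]) (by simp)]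
    simp
  · rw [if_neg hbc]
    exact Finset.sum_eq_zero fun a _ => by
      split_ifs with h
      · exact absurd h.2 hbc
      · rfl

/-- The slices of `⟨Q⟩` are linearly independent (conciseness). [folklore] -/
theorem linearIndependent_unitTensor (Q : ℕ) :
    LinearIndependent ℂ (fun a => unitTensor ℂ Q a : Fin Q → Fin Q → Fin Q → ℂ) := by
  rw [Fintype.linearIndependent_iff]
  intro g hg b
  have h := congr_fun (congr_fun hg b) b
  rw [Finset.sum_apply, Finset.sum_apply, Fintype.sum_eq_single b] at h
  · simpa using h
  · intro a ha
    simp [ha]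

/-! ## 3. The packing slack law and its corollaries -/

/-- **Packing slack law.**  `⟨B⟩ ⊗ ⟨m,m,m⟩ ≤ cw₂^{⊠N}` with `B, m ≥ 1` forces
`2^N + 2·B·m² ≤ m + 2·3^N`, i.e. `2·(3^N − B·m²) ≥ 2^N − m`. [new] -/
theorem slack_law {N F m : ℕ} (hF : 0 < F) (hm : 0 < m)
    (h : TensorRestrictsTo (kroneckerPow (cwTensor ℂ 2) N)
      (kroneckerTensor (unitTensor ℂ F) (matMulTensor ℂ m m m))) :
    2 ^ N + 2 * (F * m ^ 2) ≤ m + 2 * 3 ^ N := by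
  classical
  haveI : NeZero m := ⟨hm.ne'⟩
  set p₀ : Fin F × (Fin m × Fin m) := (⟨0, hF⟩, (⟨0, hm⟩, ⟨0, hm⟩)) with hp₀
  have hξ : (fun a : Fin F × (Fin m × Fin m) => if a = p₀ then (1 : ℂ) else 0) ≠ 0 := by
    intro h0
    have := congr_fun h0 p₀
    simp at this
  have key := floor_le_of_restricts (fun η hη => two_pow_le_rank_sliceMat_cwPow hη)
    (linearIndependent_pack F m) (linearIndependent_rotate_pack F m)
    (linearIndependent_rotate_rotate_pack F m) hξ (rank_sliceMat_pack_single_le F m p₀) h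
  simp only [Fintype.card_prod, Fintype.card_fin, Fintype.card_fun, Nat.reduceAdd] at key
  rw [sq]
  generalize F * (m * m) = V at key ⊢
  omega

/-- **Packing into `n` copies.**  `⟨B⟩ ⊗ ⟨m,m,m⟩ ≤ ⟨n⟩ ⊠ cw₂^{⊠N}` (`B, m ≥ 1`) forces
`2^N + 2·B·m² ≤ m + 2·n·3^N`: the floor is a one-slice invariant and does not grow with `n`. [new] -/
theorem slack_law_copies {n N F m : ℕ} (hF : 0 < F) (hm : 0 < m)
    (h : TensorRestrictsTo (kroneckerTensor (unitTensor ℂ n) (kroneckerPow (cwTensor ℂ 2) N))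
      (kroneckerTensor (unitTensor ℂ F) (matMulTensor ℂ m m m))) :
    2 ^ N + 2 * (F * m ^ 2) ≤ m + 2 * (n * 3 ^ N) := by
  classical
  haveI : NeZero m := ⟨hm.ne'⟩
  set p₀ : Fin F × (Fin m × Fin m) := (⟨0, hF⟩, (⟨0, hm⟩, ⟨0, hm⟩)) with hp₀
  have hξ : (fun a : Fin F × (Fin m × Fin m) => if a = p₀ then (1 : ℂ) else 0) ≠ 0 := by
    intro h0
    have := congr_fun h0 p₀
    simp at this
  have hfloor : ∀ η : Fin n × (Fin N → Fin 3) → ℂ, η ≠ 0 →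
      2 ^ N ≤ (sliceMat (kroneckerTensor (unitTensor ℂ n) (kroneckerPow (cwTensor ℂ 2) N)) η).rank :=
    fun η hη => by
      rw [sliceMat_eq_contract3]
      exact two_pow_le_rank_contract3_unitKronecker_cwTwoPow hη
  have key := floor_le_of_restricts hfloor
    (linearIndependent_pack F m) (linearIndependent_rotate_pack F m)
    (linearIndependent_rotate_rotate_pack F m) hξ (rank_sliceMat_pack_single_le F m p₀) h
  simp only [Fintype.card_prod, Fintype.card_fin, Fintype.card_fun, Nat.reduceAdd] at key
  rw [sq]
  generalize F * (m * m) = V at key ⊢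
  omega

/-- **Subrank floor.**  `⟨Q⟩ ≤ cw₂^{⊠N}` forces `2^N + 2·Q ≤ 1 + 2·3^N`, i.e.
`Q(cw₂^{⊠N}) ≤ 3^N − ⌈(2^N − 1)/2⌉` (tight at `N = 1`: `Q(cw₂) = 2`). [new] -/
theorem subrank_floor_of_restricts {N Q : ℕ}
    (h : TensorRestrictsTo (kroneckerPow (cwTensor ℂ 2) N) (unitTensor ℂ Q)) :
    2 ^ N + 2 * Q ≤ 1 + 2 * 3 ^ N := by
  classical
  rcases Nat.eq_zero_or_pos Q with rfl | hQ
  · have : 2 ^ N ≤ 3 ^ N := Nat.pow_le_pow_left (by norm_num) N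
    omega
  set q₀ : Fin Q := ⟨0, hQ⟩
  have hξ : (fun a : Fin Q => if a = q₀ then (1 : ℂ) else 0) ≠ 0 := by
    intro h0
    have := congr_fun h0 q₀
    simp at this
  have hρ : (sliceMat (unitTensor ℂ Q) (fun a : Fin Q => if a = q₀ then (1 : ℂ) else 0)).rank ≤ 1 := by
    rw [sliceMat_unitTensor, Matrix.rank_diagonal, Fintype.card_subtype]
    simp [Finset.filter_eq']
  have h1 := linearIndependent_unitTensor Q
  have h2 : LinearIndependent ℂ (fun b' => rotate (unitTensor ℂ Q) b' : Fin Q → Fin Q → Fin Q → ℂ) := by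
    rw [OutsiderSandwichTightSubrank.rotate_unitTensor]; exact h1
  have h3 : LinearIndependent ℂ
      (fun c' => rotate (rotate (unitTensor ℂ Q)) c' : Fin Q → Fin Q → Fin Q → ℂ) := by
    rw [OutsiderSandwichTightSubrank.rotate_unitTensor,
      OutsiderSandwichTightSubrank.rotate_unitTensor]; exact h1
  have key := floor_le_of_restricts (fun η hη => two_pow_le_rank_sliceMat_cwPow hη) h1 h2 h3 hξ hρ h
  simp only [Fintype.card_fin, Fintype.card_fun, Nat.reduceAdd] at key
  omega

/-- `Q(cw₂^{⊠N})` itself: `2^N + 2·Q(cw₂^{⊠N}) ≤ 1 + 2·3^N`. [new] -/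
theorem subrank_floor (N : ℕ) :
    2 ^ N + 2 * subrank ℂ (kroneckerPow (cwTensor ℂ 2) N) ≤ 1 + 2 * 3 ^ N :=
  subrank_floor_of_restricts
    (Literature.Barriers.MatrixMultiplication.restrictsTo_unitTensor_subrank _)

/-- The two-sided subrank window of the tower: `2^N ≤ Q(cw₂^{⊠N}) ≤ 3^N − ⌈(2^N − 1)/2⌉`
(lower: the tree's zeroing diagonal `cwPow_restrictsTo_unitTensor`). [new] -/
theorem subrank_window (N : ℕ) :
    2 ^ N ≤ subrank ℂ (kroneckerPow (cwTensor ℂ 2) N) ∧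
      2 ^ N + 2 * subrank ℂ (kroneckerPow (cwTensor ℂ 2) N) ≤ 1 + 2 * 3 ^ N :=
  ⟨Literature.Barriers.MatrixMultiplication.le_subrank_of_restrictsTo
      (OutsiderSandwichDegenerationWitness.cwPow_restrictsTo_unitTensor N),
    subrank_floor N⟩

/-- **`Q(cw₂^{⊠1}) = 2`**: the window closes at `N = 1` (`2 ≤ Q`, `2 + 2Q ≤ 7`). [new] -/
theorem subrank_cwPow_one : subrank ℂ (kroneckerPow (cwTensor ℂ 2) 1) = 2 := by
  obtain ⟨h1, h2⟩ := subrank_window 1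
  omega

/-- **The exact law re-derived from the slack law**: `⟨B⟩ ⊗ ⟨m,m,m⟩ ≤ cw₂^{⊠N}`, `N ≥ 1` ⟹
`B·m² < 3^N` (`m² ≤ 3^N < 4^N` gives `m < 2^N`, and then the slack is positive) — the unfolded form
of the closed aside `CwTwoNoExactPerfectPacking` (stmt-MatrixMultiplication-32272), whose by-name
closer stays gen 37's `cwTwoNoExactPerfectPacking_holds`. [new] -/
theorem mul_sq_lt_three_pow_of_slack {N F m : ℕ} (hN : 1 ≤ N)
    (h : TensorRestrictsTo (kroneckerPow (cwTensor ℂ 2) N)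
      (kroneckerTensor (unitTensor ℂ F) (matMulTensor ℂ m m m))) :
    F * m ^ 2 < 3 ^ N := by
  have h3 : 0 < 3 ^ N := by positivity
  rcases Nat.eq_zero_or_pos F with rfl | hF
  · simp [h3]
  rcases Nat.eq_zero_or_pos m with rfl | hm
  · simp [h3]
  have hvol := mul_sq_le_three_pow h
  have hlaw := slack_law hF hm h
  have h34 : 3 ^ N < 4 ^ N := Nat.pow_lt_pow_left (by norm_num) (by omega)
  have hm2 : m < 2 ^ N := by
    by_contra hle
    rw [not_lt] at hle
    have hmm : 2 ^ N * 2 ^ N ≤ m * m := Nat.mul_le_mul hle hle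
    have h4 : (4 : ℕ) ^ N = 2 ^ N * 2 ^ N := by
      rw [show (4 : ℕ) = 2 * 2 by norm_num, mul_pow]
    have : m * m ≤ F * m ^ 2 := by
      rw [sq]; exact Nat.le_mul_of_pos_left _ hF
    omega
  omega

/-! ## 4. Census cells beyond volume -/

/-- `19` disjoint `⟨2,2,2⟩` do not restrict from `cw₂^{⊠4}` (volume allows `20`: `80 < 81`). [new] -/
theorem not_pack_nineteen_two_le_cwPow_four :
    ¬ TensorRestrictsTo (kroneckerPow (cwTensor ℂ 2) 4)
      (kroneckerTensor (unitTensor ℂ 19) (matMulTensor ℂ 2 2 2)) :=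
  fun h => absurd (slack_law (by norm_num) (by norm_num) h) (by norm_num)

/-- `5` disjoint `⟨4,4,4⟩` do not restrict from `cw₂^{⊠4}` (volume allows `5`: `80 < 81`). [new] -/
theorem not_pack_five_four_le_cwPow_four :
    ¬ TensorRestrictsTo (kroneckerPow (cwTensor ℂ 2) 4)
      (kroneckerTensor (unitTensor ℂ 5) (matMulTensor ℂ 4 4 4)) :=
  fun h => absurd (slack_law (by norm_num) (by norm_num) h) (by norm_num)

/-- `26` disjoint `⟨3,3,3⟩` do not restrict from `cw₂^{⊠5}` (volume allows `26`: `234 < 243`; the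
critic's census hand `(5,3,25/26)` of gen 37). [new] -/
theorem not_pack_twentysix_three_le_cwPow_five :
    ¬ TensorRestrictsTo (kroneckerPow (cwTensor ℂ 2) 5)
      (kroneckerTensor (unitTensor ℂ 26) (matMulTensor ℂ 3 3 3)) :=
  fun h => absurd (slack_law (by norm_num) (by norm_num) h) (by norm_num)

/-- `44` disjoint `⟨4,4,4⟩` do not restrict from `cw₂^{⊠6}` (volume allows `45`: `720 < 729`). [new] -/
theorem not_pack_fortyfour_four_le_cwPow_six :
    ¬ TensorRestrictsTo (kroneckerPow (cwTensor ℂ 2) 6)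
      (kroneckerTensor (unitTensor ℂ 44) (matMulTensor ℂ 4 4 4)) :=
  fun h => absurd (slack_law (by norm_num) (by norm_num) h) (by norm_num)

/-- `11` disjoint `⟨8,8,8⟩` do not restrict from `cw₂^{⊠6}` (volume allows `11`: `704 < 729`). [new] -/
theorem not_pack_eleven_eight_le_cwPow_six :
    ¬ TensorRestrictsTo (kroneckerPow (cwTensor ℂ 2) 6)
      (kroneckerTensor (unitTensor ℂ 11) (matMulTensor ℂ 8 8 8)) :=
  fun h => absurd (slack_law (by norm_num) (by norm_num) h) (by norm_num)

/-- `⟨8⟩ ≰ cw₂^{⊠2}` (volume allows `9`; the floor gives `Q(cw₂^{⊠2}) ≤ 7`). [new] -/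
theorem not_unit_eight_le_cwPow_two :
    ¬ TensorRestrictsTo (kroneckerPow (cwTensor ℂ 2) 2) (unitTensor ℂ 8) :=
  fun h => absurd (subrank_floor_of_restricts h) (by norm_num)

end Summit.MatrixMultiplication.MatrixMultiplication.Theorems.OutsiderSandwichPackingSlack
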